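import Summits.ABC.StewartYu.PadicG3SupplyHalf
import HarnessLib

/-!
# Cell abc-stewartyu, crux `Y07Odd` (stmt-ABC-19658), line `gen3-slab-odd`: the record packages from ONE INEQUALITY each — closed forms for
# `Bw`, `den₀`, `M₀`, `Xb`, `K` (k-steps) filled in from `PadicG3Supply`, so that the record owner proves only `hfinal`

`Summits/ABC/StewartYu/PadicG3PackClosed.lean` — cell `abc-stewartyu` (seat p2-g4, F-odd lead; for p1 g7/g8).  Definitions (the closed forms `BwC`,
`M0C`, `XbC`, `KC`) and theorems on `G3Setup`; no named fact.

* `norm_inv_natCast_le` (`‖d⁻¹‖_p ≤ d`), `hBw_closed`, `hR_closed`, `hXb_closed`;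
* **`kStepHypU_of_ineq`**, **`kStepOddHypU_of_ineq`** — the packages `KStepHypU` / `KStepOddHypU` for the level polynomials
  `Rl H Ŝ lev` on `U = unk L₀ 𝔏` with box `L`, from `1 ≤ t`, `T′ + t ≤ T`, `1 ≤ H` and the single numerical inequality
  `max (BwC·‖Λ/b_{j₀}‖·p^{⌊(t−1)/2⌋}·p^{condExp}) (BwC/(p^m√p)^{zeros}) < 1 / KC` at the new points.

WHAT THIS IS NOT: the half-step package (`halfStepHypU_of_ineq`, sequel) and the inequalities themselves (record); no crux moves.

References: Yu. V. Nesterenko, LNM 1819 (2003) §3.1, §4.2; K. Yu, Acta Math. 211 (2013) Lemma 5.2.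
-/

noncomputable section

open NormedSpace Finset Polynomial
open Literature.NumberTheory.Transcendental
open Literature.NumberTheory.Transcendental (FeldmanDelta.den)
open Literature.NumberTheory.Transcendental.FeldmanDelta
open Literature.NumberTheory.Transcendental.PadicCW77 (condExp)
open Literature.NumberTheory.Transcendental.CW77.Setup (Tau tauNorm)
open scoped Nat

namespace Summit.ABC.StewartYu

namespace G3Setup

variable {p : ℕ} [Fact p.Prime] (S : G3Setup p)

/-! ### Closed forms -/

/-- The weighted coefficient bound: `BwC = (Σ_{ℓ₀ ≤ L₀} den(ℓ₀,H)) · ρ^{L₀}`, `ρ = p^m√p`. [folklore] -/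
def BwC (L₀ H m : ℕ) : ℝ := (∑ ℓ₀ ∈ range (L₀ + 1), (den ℓ₀ H : ℝ)) * ((p : ℝ) ^ m * Real.sqrt p) ^ L₀

/-- The size of the cleared Hasse values at level `lev`: `⌈2^{(Ŝ−lev)t₀} ν(H)^{t₀} e^{H/e} (e(1+2^{Ŝ−lev}|x|/H))^{L₀}⌉`. [folklore] -/
def M0C (L₀ H Sh lev : ℕ) (x : ℤ) (t₀ : ℕ) : ℤ :=
  ⌈(2 : ℝ) ^ ((Sh - lev) * t₀) * ((Nat.lcmUpto H : ℝ) ^ t₀ *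
    (Real.exp (H / Real.exp 1) * (Real.exp 1 * (1 + |((2 ^ (Sh - lev) * x : ℤ) : ℝ)| / H)) ^ L₀))⌉

/-- The directional bound on a box: `XbC = 2 · (Σ_j |b_j|) · (Σ_j L_j)`. [folklore] -/
def XbC (L : Fin S.n → ℕ) : ℤ := 2 * ((∑ j, |S.b j|) * ∑ j, (L j : ℤ))

/-- The Liouville constant of the k-step: `KC = 1 + #U · P · M0C · XbC^{|t|} · monDen(α, L·|x|)²`. [folklore] -/
def KC (U : ℕ) (P : ℤ) (L₀ H Sh lev : ℕ) (L : Fin S.n → ℕ) (x : ℤ) (τ : Tau S.n) : ℝ :=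
  1 + (U : ℝ) * P * ((M0C L₀ H Sh lev x τ.1 : ℝ) * (S.XbC L : ℝ) ^ (∑ k, τ.2 k) * ((MonomialDen.monDen S.α (S.boxExpG L x) : ℝ)) ^ 2)

/-! ### The structural hypotheses in closed form -/

/-- `‖d⁻¹‖_p ≤ d` for a natural number `d ≥ 1`. [folklore] -/
theorem norm_inv_natCast_le {d : ℕ} (hd : 1 ≤ d) : ‖((d : ℚ_[p]))⁻¹‖ ≤ (d : ℝ) := by
  have h := PadicCW77.one_div_le_norm_natCast (p := p) (n := d) (by omega)
  have hd0 : (0 : ℝ) < d := by exact_mod_cast hd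
  have hn0 : 0 < ‖(d : ℚ_[p])‖ := lt_of_lt_of_le (by positivity) h
  rw [norm_inv]
  calc ‖(d : ℚ_[p])‖⁻¹ ≤ ((1 : ℝ) / d)⁻¹ := inv_anti₀ (by positivity) h
    _ = d := by rw [one_div, inv_inv]

/-- **`hBw` in closed form.** [folklore] -/
theorem hBw_closed (L₀ H Sh lev m : ℕ) (𝔏 : Finset (Fin S.n → ℤ)) :
    ∀ i ∈ S.unk L₀ 𝔏, ∀ t₀ k, ‖(hw (p := p) (S.Rl H Sh lev) i t₀).coeff k‖ * ((p : ℝ) ^ m * Real.sqrt p) ^ k ≤ BwC (p := p) L₀ H m := by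
  intro i hi t₀ k
  have hi1 : i.1 ≤ L₀ := by
    unfold unk at hi; have := (mem_product.mp hi).1; rw [mem_range] at this; omega
  have hρ1 : (1 : ℝ) ≤ (p : ℝ) ^ m * Real.sqrt p := by
    have hs : 1 ≤ Real.sqrt p := by
      rw [show (1 : ℝ) = Real.sqrt 1 by simp]; exact Real.sqrt_le_sqrt S.one_lt_p.le
    calc (1 : ℝ) = 1 * 1 := (mul_one 1).symm
      _ ≤ _ := mul_le_mul (one_le_pow₀ S.one_lt_p.le) hs zero_le_one (by positivity)
  refine (S.norm_coeff_hw_Rl_mul_pow_le H Sh lev i t₀ k hρ1).trans ?_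
  unfold BwC
  refine mul_le_mul ?_ (pow_le_pow_right₀ hρ1 hi1) (by positivity) (sum_nonneg fun _ _ => by positivity)
  refine (norm_inv_natCast_le (den_pos i.1 H)).trans ?_
  exact single_le_sum (f := fun ℓ₀ => (den ℓ₀ H : ℝ)) (fun _ _ => by positivity) (mem_range.mpr (by omega))

/-- **`hR` in closed form** (`den₀ = ν(H)^{t₀}`, `M₀ = M0C`). [folklore] -/
theorem hR_closed {H : ℕ} (hH : 1 ≤ H) (L₀ Sh lev : ℕ) (𝔏 : Finset (Fin S.n → ℤ)) :
    ∀ (x : ℤ) (τ : Tau S.n), ∀ i ∈ S.unk L₀ 𝔏, ∃ z₀ : ℤ,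
      (((Nat.lcmUpto H) ^ τ.1 : ℕ) : ℚ) * (hasseDeriv τ.1 (S.Rl H Sh lev i)).eval (x : ℚ) = z₀ ∧ |z₀| ≤ M0C L₀ H Sh lev x τ.1 := by
  intro x τ i hi
  have hi1 : i.1 ≤ L₀ := by
    unfold unk at hi; have := (mem_product.mp hi).1; rw [mem_range] at this; omega
  refine S.exists_int_lcm_pow_mul_hasse_Rl hH Sh lev i τ.1 x ?_
  unfold M0C
  refine le_trans ?_ (Int.le_ceil _)
  have hbase : (1 : ℝ) ≤ Real.exp 1 * (1 + |((2 ^ (Sh - lev) * x : ℤ) : ℝ)| / H) := by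
    have h1 : (1 : ℝ) ≤ Real.exp 1 := Real.one_le_exp zero_le_one
    have h2 : (1 : ℝ) ≤ 1 + |((2 ^ (Sh - lev) * x : ℤ) : ℝ)| / H := by
      have : (0 : ℝ) ≤ |((2 ^ (Sh - lev) * x : ℤ) : ℝ)| / H := by positivity
      linarith
    nlinarith
  have hpow : (Real.exp 1 * (1 + |((2 ^ (Sh - lev) * x : ℤ) : ℝ)| / H)) ^ i.1 ≤
      (Real.exp 1 * (1 + |((2 ^ (Sh - lev) * x : ℤ) : ℝ)| / H)) ^ L₀ := pow_le_pow_right₀ hbase hi1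
  exact mul_le_mul_of_nonneg_left (mul_le_mul_of_nonneg_left (mul_le_mul_of_nonneg_left hpow (by positivity)) (by positivity))
    (by positivity)

/-- **`hXb` in closed form.** [folklore] -/
theorem hXb_closed (L : Fin S.n → ℕ) : ∀ w : Fin S.n → ℤ, (∀ j, |w j| ≤ (L j : ℤ)) → ∀ k, |S.𝔛 w k| ≤ S.XbC L := by
  intro w hw k
  refine (S.abs_𝔛_le_of_box hw k).trans ?_
  unfold XbC
  have hb0 : ∀ j, (0 : ℤ) ≤ |S.b j| := fun j => abs_nonneg _
  have hL0 : ∀ j, (0 : ℤ) ≤ (L j : ℤ) := fun j => by positivity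
  have h1 : |S.b S.j₀| ≤ ∑ j, |S.b j| := single_le_sum (f := fun j => |S.b j|) (fun j _ => hb0 j) (mem_univ _)
  have h2 : |S.b k| ≤ ∑ j, |S.b j| := single_le_sum (f := fun j => |S.b j|) (fun j _ => hb0 j) (mem_univ _)
  have h3 : (L k : ℤ) ≤ ∑ j, (L j : ℤ) := single_le_sum (f := fun j => (L j : ℤ)) (fun j _ => hL0 j) (mem_univ _)
  have h4 : (L S.j₀ : ℤ) ≤ ∑ j, (L j : ℤ) := single_le_sum (f := fun j => (L j : ℤ)) (fun j _ => hL0 j) (mem_univ _)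
  have hS0 : (0 : ℤ) ≤ ∑ j, |S.b j| := sum_nonneg fun j _ => hb0 j
  have hT0 : (0 : ℤ) ≤ ∑ j, (L j : ℤ) := sum_nonneg fun j _ => hL0 j
  have e1 : |S.b S.j₀| * (L k : ℤ) ≤ (∑ j, |S.b j|) * ∑ j, (L j : ℤ) := mul_le_mul h1 h3 (hL0 k) hS0
  have e2 : |S.b k| * (L S.j₀ : ℤ) ≤ (∑ j, |S.b j|) * ∑ j, (L j : ℤ) := mul_le_mul h2 h4 (hL0 S.j₀) hS0
  linarith

/-! ### The k-step packages from one inequality -/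

/-- **`KStepHypU` from one inequality.** [cite: Nesterenko2003, §4.2; shape only] -/
theorem kStepHypU_of_ineq {H : ℕ} (hH : 1 ≤ H) (L₀ Sh lev m : ℕ) (𝔏 : Finset (Fin S.n → ℤ)) (L : Fin S.n → ℕ) (P : ℤ)
    (hP : (0 : ℤ) ≤ P) {N N' T T' t : ℕ} (ht : 1 ≤ t) (hT : T' + t ≤ T)
    (hfinal : ∀ x₁ : ℤ, |x₁| ≤ (N' : ℤ) → ∀ τ : Tau S.n, tauNorm τ + t ≤ T →
      max (BwC (p := p) L₀ H m * ‖S.Λ / (S.b S.j₀ : ℚ_[p])‖ * (p : ℝ) ^ ((t - 1) / 2) * (p : ℝ) ^ condExp p (2 * N + 1) t)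
        (BwC (p := p) L₀ H m / ((p : ℝ) ^ m * Real.sqrt p) ^ ((2 * N + 1) * t)) <
      1 / S.KC (S.unk L₀ 𝔏).card P L₀ H Sh lev L x₁ τ) :
    S.KStepHypU (S.Rl H Sh lev) (S.unk L₀ 𝔏) L P m N N' T T' := by
  refine ⟨t, BwC (p := p) L₀ H m, fun (_ : ℤ) (τ : Tau S.n) => (Nat.lcmUpto H) ^ τ.1, fun (x : ℤ) (τ : Tau S.n) => M0C L₀ H Sh lev x τ.1,
    S.XbC L, fun x τ => S.KC (S.unk L₀ 𝔏).card P L₀ H Sh lev L x τ, ht, hT, ?_, S.hBw_closed L₀ H Sh lev m 𝔏,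
    fun _ τ => Nat.one_le_pow _ _ (Nat.lcmUpto_pos H), S.hR_closed hH L₀ Sh lev 𝔏, S.hXb_closed L, ?_, ?_, hfinal⟩
  · unfold BwC; exact mul_nonneg (sum_nonneg fun _ _ => by positivity) (by positivity)
  · intro x τ
    unfold KC
    have hP' : (0 : ℝ) ≤ P := by exact_mod_cast hP
    have hM : (0 : ℝ) ≤ M0C L₀ H Sh lev x τ.1 := by
      have h0 : (0 : ℤ) ≤ M0C L₀ H Sh lev x τ.1 := by
        unfold M0C; exact Int.ceil_nonneg (by positivity)
      exact_mod_cast h0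
    have hX : (0 : ℝ) ≤ S.XbC L := by
      have h0 : (0 : ℤ) ≤ S.XbC L := by
        unfold XbC
        exact mul_nonneg (by norm_num) (mul_nonneg (sum_nonneg fun j _ => abs_nonneg _) (sum_nonneg fun j _ => by positivity))
      exact_mod_cast h0
    positivity
  · intro x τ
    show _ ≤ S.KC _ P L₀ H Sh lev L x τ
    unfold KC
    linarith

/-- **`KStepOddHypU` from one inequality** (odd nodes `|x| ≤ 2N−1`). [cite: Nesterenko2003, §4.2; shape only] -/
theorem kStepOddHypU_of_ineq {H : ℕ} (hH : 1 ≤ H) (L₀ Sh lev m : ℕ) (𝔏 : Finset (Fin S.n → ℤ)) (L : Fin S.n → ℕ) (P : ℤ)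
    (hP : (0 : ℤ) ≤ P) {N N' T T' t : ℕ} (ht : 1 ≤ t) (hT : T' + t ≤ T)
    (hfinal : ∀ x₁ : ℤ, |x₁| ≤ (N' : ℤ) → ∀ τ : Tau S.n, tauNorm τ + t ≤ T →
      max (BwC (p := p) L₀ H m * ‖S.Λ / (S.b S.j₀ : ℚ_[p])‖ * (p : ℝ) ^ ((t - 1) / 2) * (p : ℝ) ^ condExp p (2 * N) t)
        (BwC (p := p) L₀ H m / ((p : ℝ) ^ m * Real.sqrt p) ^ ((2 * N) * t)) <
      1 / S.KC (S.unk L₀ 𝔏).card P L₀ H Sh lev L x₁ τ) :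
    S.KStepOddHypU (S.Rl H Sh lev) (S.unk L₀ 𝔏) L P m N N' T T' := by
  refine ⟨t, BwC (p := p) L₀ H m, fun (_ : ℤ) (τ : Tau S.n) => (Nat.lcmUpto H) ^ τ.1, fun (x : ℤ) (τ : Tau S.n) => M0C L₀ H Sh lev x τ.1,
    S.XbC L, fun x τ => S.KC (S.unk L₀ 𝔏).card P L₀ H Sh lev L x τ, ht, hT, ?_, S.hBw_closed L₀ H Sh lev m 𝔏,
    fun _ τ => Nat.one_le_pow _ _ (Nat.lcmUpto_pos H), S.hR_closed hH L₀ Sh lev 𝔏, S.hXb_closed L, ?_, ?_, hfinal⟩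
  · unfold BwC; exact mul_nonneg (sum_nonneg fun _ _ => by positivity) (by positivity)
  · intro x τ
    unfold KC
    have hP' : (0 : ℝ) ≤ P := by exact_mod_cast hP
    have hM : (0 : ℝ) ≤ M0C L₀ H Sh lev x τ.1 := by
      have h0 : (0 : ℤ) ≤ M0C L₀ H Sh lev x τ.1 := by
        unfold M0C; exact Int.ceil_nonneg (by positivity)
      exact_mod_cast h0
    have hX : (0 : ℝ) ≤ S.XbC L := by
      have h0 : (0 : ℤ) ≤ S.XbC L := by
        unfold XbC
        exact mul_nonneg (by norm_num) (mul_nonneg (sum_nonneg fun j _ => abs_nonneg _) (sum_nonneg fun j _ => by positivity))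
      exact_mod_cast h0
    positivity
  · intro x τ
    show _ ≤ S.KC _ P L₀ H Sh lev L x τ
    unfold KC
    linarith

end G3Setup

end Summit.ABC.StewartYu

end
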